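import Summits.QuantumFields.BalabanUV.T4Continuum.Support.NE3LatticeWeitzenbock
import Summits.QuantumFields.BalabanUV.T4Continuum.Support.NE3FlatHessianCurl
import Summits.QuantumFields.BalabanUV.T4Continuum.Support.NE3EnergyWeightedShapes
import Summits.QuantumFields.BalabanUV.T4Continuum.Support.NE3CoercivityScaling
import HarnessLib

/-!
# T⁴ programme, node NE3 — (ML_w) AT THE FLAT BACKGROUND, ASSEMBLED MODULO THE BLOCK-POINCARÉ LEAF (w3):
# `WeightedTangentCoercive L k 1 T (1/(n(1 + C_P))) [0, N·L^k)^d` from (w1) + (w2) + a Poincaré hypothesis on `T`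

NE3 formalisation swarm, LEAF PROVER 02 (unit `b2b-balaban-t4-ne3-formalise-leaf-02`, gen 4; cell `pub-balaban`).  Owner
skeleton `SKELETON-NE3-P1.md` v1.9 §4b, socket E-ML_w = `NE3EnergyWeightedShapes.WeightedTangentCoercive` (p217682): «(w1) +
(w2) + (w3) ⇒ c_w(flat) = 1/(n(1 + C_P)) = (ML_w) AT THE FLAT BACKGROUND (the assembly line is a one-screen corollary)».  THIS
FILE is that corollary, with the block-Poincaré leaf (w3) (row E-MLw-w3, another seat) entering as an explicit HYPOTHESIS `hP`
on the direction set — nothing of (w3) is proved or restated here.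

INPUTS BY NAME.  (w1) `NE3FlatHessianCurl.hess_flatCfg_eq_sum_nhsNormSq` (leaf-03-g5, p218926): for skew `Y`,
`hess 1 Y Y W = Σ_{p∈W} nhsNormSq (d_1 Y)(p)`; (w2) `NE3LatticeWeitzenbock.weitzenbock_nhs_periodBox_of_flatDiv_eq_zero` (this
seat, p219171): for periodic `Y` with `flatDiv Y = 0`, `Σ nhsNormSq (∇Y) = Σ nhsNormSq (d_1 Y)` over one period; the one-sided
operator-norm passages `curlSq_flatCfg_le_card_mul`, `dirSq_le_card_mul`; the socket `WeightedTangentCoercive`, `energyNormW`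
(owner); the constrained Landau tangent space `NE3CoercivityScaling.flatTangentLandau` (row NE3-R2).

CONTENT ([folklore] bookkeeping; 0 `def`, 0 sorry; `n := Fintype.card n ≥ 1`, window `F = periodBox (N·L^k)`, `1 ≤ N·L^k`):
* **`weightedTangentCoercive_flatCfg_of_dirSq_le`** — for ANY direction set `T` of skew, `(N·L^k)`-periodic, `flatDiv`-free
  fields: if `∀ Y ∈ T, dirSq Y F ≤ K·(L^k)²·Σ_F Σ_μ Σ_ν nhsNormSq (Y(x+e_μ)_ν − Y(x)_ν)` (`K ≥ 0`; the operator-norm bond energy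
  against the HS gradient energy — the form every variant of (w3) reduces to by `dirSq_le_card_mul`), then
  `WeightedTangentCoercive L k flatCfg T (1/(n + K)) F`.  Proof: `energyNormW² = curlSq + (L^k)⁻²·dirSq ≤ n·C + K·C`, where
  `C = Σ_F Σ_π nhsNormSq (d_1 Y)` is `hess 1 Y Y (F ×ˢ univ)` by (w1) and the gradient energy is `C` by (w2);
* **`weightedTangentCoercive_flatCfg_of_poincare`** — the same with (w3) in the pure HS currency
  `Σ_F Σ_κ nhsNormSq (Y x κ) ≤ C_P·(L^k)²·Σ_F Σ_μ Σ_ν nhsNormSq (∇Y)`: constant **`1/(n·(1 + C_P))`** — the owner's `c_w(flat)`;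
* **`weightedTangentCoercive_flatCfg_of_dirSq_le_opGrad`** — the same with (w3) in the OPERATOR-NORM currency on both sides,
  `dirSq Y F ≤ C·(L^k)²·Σ_F Σ_μ Σ_ν ‖∇Y‖²` (row E-MLw-w3's SHAPE v1 (P) literally): constant `1/(n·(1 + C))`;
* **`weightedTangentCoercive_flatTangentLandau_of_dirSq_le`**, **`…_of_poincare`**, **`…_of_dirSq_le_opGrad`** —
  `T := flatTangentLandau L N k` (skew ∧ periodic ∧ `TangentIter L (k−1) 1` ∧ `flatDiv = 0`), the Poincaré hypothesis quantified
  over that set (where (w3) uses the tangency);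
* **`weightedTangentCoercive_flatTangentLandau_of_blockPoincare`** — THE HOOK for row E-MLw-w3's END in its LITERAL shape
  (`Σ_κ Σ_μ` order, `BlockAveragePushDirSplit.flat`, level `j = k − 1`; leaf-04-g4 «GO w2-asm» 13:37Z): discharge by `exact`;
* **`weightedPoincare_flatCfg_of_dirSq_le`**, **`weightedPoincare_flatTangentLandau_of_blockPoincare`** — (P_W) AT `W = 1` in the
  literal (P_U) currency of `NE3WeightedCoercivityTransfer` (leaf-03-g6, E-MLw-w4-T): `(L^k)⁻²·dirSq Y F ≤ K·curlSq 1 Y F` on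
  `flatDiv`-free periodic `T` ∕ on `flatTangentLandau L N k` (constant `card n·C_P` from (w3)'s END) — «at `W = flatCfg` (P_W)
  follows from (w2) + (w3) + Landau», kernel-checked;
* `flatDiv_eq_sum` (`rfl` bridge to (w2)'s spelled-out divergence), `sum_nhsNormSq_curl_le_curlSq`, `sum_opNorm_grad_le_card_mul`;
  `energyNormW²` is unfolded inline (the lemma `energyNormW_sq` is `NE3WeightedCoercivityTransfer`'s, p219420 — not restated).
Whether `C_P` may be taken `k`-free AND `N`-free on `flatTangentLandau` is (w3)'s question (leaf-04-g4, CLAIM l.13219: provable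
with `C(d)·N²`, `k`-free; an `N`-free constant is doubtful on the single-bar tangent space) — this file is agnostic: `K`, `C_P` are
parameters.

HONEST FRAMING.  A composition at ONE (flat) configuration, CONDITIONAL on the typed Poincaré hypothesis `hP`; (ML_w) at a
general small background ((w4)) is not touched; nothing about minimisers; T-E_w, NE3 NOT proved; spine PROVED 0/9; finite T⁴
rung (B)+1 — NOT infinite volume, NOT mass gap, NOT `BetaPertH`, NOT Clay.  HONEST DEPENDENCY: continuum YM on T⁴ ⇐ BetaPertH ∧
nine spine estimates (0/9 proved); BetaPertH ⇐ (D1) ∧ (D4) ∧ CAP+tail; G-an2-4 gates asym, D1 and NE2/3/4.  ABSOLUTE RULE kept: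
no printed sentence is a hypothesis (context only: [Balaban1985PropagatorsII] Thm 3.3 (3.46), [Balaban1984PropagatorsII]
(2.153)); no `def … : Prop`.  PLACEMENT: our work, `Summits/QuantumFields/BalabanUV/`; imports accepted modules only.
-/

set_option autoImplicit false

open scoped BigOperators Matrix Matrix.Norms.L2Operator
open Finset

namespace Summit.QuantumFields.BalabanUV.T4Continuum.NE3FlatWeightedCoercive

open Literature.MathematicalPhysics.QuantumFieldTheory.Balaban1983to89
open B7Prop1Explicit (Site e)
open T4AveragingDeficitWall (curlAt curl curlSq dirSq IsSkewDir)
open T4AveragingDeficitWallBoundary (periodBox)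
open AveragingDeficitPeriodicCounting (IsPeriodicDir)
open MinimalActionWitness (flatCfg)
open MatrixNorms (nhsNormSq nhsNormSq_nonneg)
open NE3HessForm (hess)
open NE3HessShapes (plaqsOf sum_plaqsOf)
open NE3EnergyWeightedShapes (energyNormW WeightedTangentCoercive)
open NE3CoercivityScaling (flatDiv flatTangentLandau)
open NE3FlatHessianCurl (hess_flatCfg_eq_sum_nhsNormSq)
open NE3LatticeWeitzenbock (weitzenbock_nhs_periodBox_of_flatDiv_eq_zero curlSq_flatCfg_le_card_mul dirSq_le_card_mul
  sum_plaqsOf_nhsNormSq_curl)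

noncomputable section

variable {d : ℕ} {n : Type*} [Fintype n] [DecidableEq n]

/-! ## §1 Bridges -/

omit [Fintype n] [DecidableEq n] in
/-- `flatDiv Y x` IS (w2)'s spelled-out backward divergence `Σ_μ (Y(x)_μ − Y(x−e_μ)_μ)`. [folklore] -/
theorem flatDiv_eq_sum (Y : Site d → Fin d → Matrix n n ℂ) (x : Site d) :
    flatDiv Y x = ∑ μ : Fin d, (Y x μ - Y (x - e μ) μ) := rfl

/-- At the flat configuration the Wilson Hessian of a skew direction over the window `F ×ˢ univ` IS the HS curl energy
`Σ_{x∈F} Σ_π nhsNormSq ((d_1 Y)(x; π))` ((w1) BY NAME, re-indexed by sites and planes). [folklore] -/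
theorem hess_flatCfg_eq_sum_sum {Y : Site d → Fin d → Matrix n n ℂ} (hY : IsSkewDir Y) (F : Finset (Site d)) :
    hess flatCfg Y Y (F ×ˢ Finset.univ)
      = ∑ x ∈ F, ∑ π : T4AveragingDeficitWall.Plane d, nhsNormSq (curlAt (flatCfg (d := d) (n := n)) Y x π.1.1 π.1.2) := by
  rw [hess_flatCfg_eq_sum_nhsNormSq hY, ← sum_plaqsOf_nhsNormSq_curl]
  rfl

/-- HS curl energy `≤` operator-norm curl energy at the flat configuration (`nhsNormSq ≤ ‖·‖²` termwise): the passage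
to the `curlSq` of (P_U)-type hypotheses (`NE3WeightedCoercivityTransfer`). [folklore] -/
theorem sum_nhsNormSq_curl_le_curlSq (Y : Site d → Fin d → Matrix n n ℂ) (F : Finset (Site d)) :
    ∑ x ∈ F, ∑ π : T4AveragingDeficitWall.Plane d, nhsNormSq (curlAt (flatCfg (d := d) (n := n)) Y x π.1.1 π.1.2)
      ≤ curlSq (flatCfg (d := d) (n := n)) Y F :=
  Finset.sum_le_sum fun _ _ => Finset.sum_le_sum fun _ _ => MatrixNorms.nhsNormSq_le_opNorm_sq _

/-! ## §2 (ML_w) at the flat background from a Poincaré hypothesis on the direction set -/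

/-- **(ML_w) AT THE FLAT BACKGROUND, MODULO THE POINCARÉ LEAF — operator-norm bond energy against HS gradient energy.**
For a set `T` of skew, `(N·L^k)`-periodic, backward-divergence-free direction fields on which
`dirSq Y F ≤ K·(L^k)²·Σ_F Σ_μ Σ_ν nhsNormSq (Y(x+e_μ)_ν − Y(x)_ν)` (`F = [0, N·L^k)^d`, `K ≥ 0`):
`WeightedTangentCoercive L k 1 T (1/(card n + K)) F`. [folklore] -/
theorem weightedTangentCoercive_flatCfg_of_dirSq_le [Nonempty n] {L N k : ℕ} (hNL : 1 ≤ N * L ^ k)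
    {T : Set (Site d → Fin d → Matrix n n ℂ)} {K : ℝ} (hK : 0 ≤ K)
    (hskew : ∀ Y ∈ T, IsSkewDir Y) (hper : ∀ Y ∈ T, IsPeriodicDir Y ((N * L ^ k : ℕ) : ℤ))
    (hdiv : ∀ Y ∈ T, ∀ x : Site d, flatDiv Y x = 0)
    (hP : ∀ Y ∈ T, dirSq Y (periodBox (N * L ^ k)) ≤ K * (((L : ℝ) ^ k) ^ 2 *
      ∑ x ∈ periodBox (N * L ^ k), ∑ μ : Fin d, ∑ ν : Fin d, nhsNormSq (Y (x + e μ) ν - Y x ν))) :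
    WeightedTangentCoercive L k (flatCfg (d := d) (n := n)) T (1 / (Fintype.card n + K)) (periodBox (N * L ^ k)) := by
  intro Y hY
  set F : Finset (Site d) := periodBox (N * L ^ k) with hF
  set C : ℝ := ∑ x ∈ F, ∑ π : T4AveragingDeficitWall.Plane d,
    nhsNormSq (curlAt (flatCfg (d := d) (n := n)) Y x π.1.1 π.1.2) with hC
  have hC0 : 0 ≤ C := Finset.sum_nonneg fun _ _ => Finset.sum_nonneg fun _ _ => nhsNormSq_nonneg _
  -- (w2): on a divergence-free periodic field the HS gradient energy is the HS curl energy `C`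
  have hG : ∑ x ∈ F, ∑ μ : Fin d, ∑ ν : Fin d, nhsNormSq (Y (x + e μ) ν - Y x ν) = C :=
    weitzenbock_nhs_periodBox_of_flatDiv_eq_zero hNL (hper Y hY) (fun x => hdiv Y hY x)
  -- (w1): the flat Hessian is `C`
  have hH : hess flatCfg Y Y (F ×ˢ Finset.univ) = C := hess_flatCfg_eq_sum_sum (hskew Y hY) F
  -- the two halves of the weighted energy norm
  have h1 : curlSq flatCfg Y F ≤ Fintype.card n * C := curlSq_flatCfg_le_card_mul Y F
  have h2 : (((L : ℝ) ^ k)⁻¹) ^ 2 * dirSq Y F ≤ K * C := by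
    have hPY := hP Y hY
    rw [hG] at hPY
    have hD0 : 0 ≤ dirSq Y F := by unfold T4AveragingDeficitWall.dirSq; positivity
    by_cases hLk : ((L : ℝ) ^ k) = 0
    · rw [hLk, inv_zero, zero_pow two_ne_zero, zero_mul]
      exact mul_nonneg hK hC0
    · calc (((L : ℝ) ^ k)⁻¹) ^ 2 * dirSq Y F ≤ (((L : ℝ) ^ k)⁻¹) ^ 2 * (K * (((L : ℝ) ^ k) ^ 2 * C)) :=
            mul_le_mul_of_nonneg_left hPY (sq_nonneg _)
        _ = K * C * ((((L : ℝ) ^ k)⁻¹) * (L : ℝ) ^ k) ^ 2 := by ring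
        _ = K * C := by rw [inv_mul_cancel₀ hLk, one_pow, mul_one]
  have hE : energyNormW L k flatCfg Y F ^ 2 ≤ (Fintype.card n + K) * C := by
    have hsq : energyNormW L k (flatCfg (d := d) (n := n)) Y F ^ 2
        = curlSq flatCfg Y F + (((L : ℝ) ^ k)⁻¹) ^ 2 * dirSq Y F := by
      unfold energyNormW
      have h1 : 0 ≤ curlSq (flatCfg (d := d) (n := n)) Y F := by unfold curlSq; positivity
      have h2 : 0 ≤ dirSq Y F := by unfold T4AveragingDeficitWall.dirSq; positivity
      rw [Real.sq_sqrt (by positivity)]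
    rw [hsq]
    linarith
  have hnK : 0 < (Fintype.card n : ℝ) + K := by
    have : (0 : ℝ) < Fintype.card n := by exact_mod_cast Fintype.card_pos
    linarith
  rw [hH]
  calc 1 / (Fintype.card n + K) * energyNormW L k flatCfg Y F ^ 2
      ≤ 1 / (Fintype.card n + K) * ((Fintype.card n + K) * C) :=
        mul_le_mul_of_nonneg_left hE (by positivity)
    _ = C := by field_simp

/-- **THE η-WEIGHTED POINCARÉ–HODGE INEQUALITY (P_W) AT `W = 1`** in the literal currency of
`NE3WeightedCoercivityTransfer.weightedTangentCoercive_of_weightedPoincare`'s hypothesis (P_U) (leaf-03-g6, E-MLw-w4-T): for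
`(N·L^k)`-periodic, `flatDiv`-free `T` with `dirSq Y F ≤ K·(L^k)²·Σ_F Σ_μ Σ_ν nhsNormSq (∇Y)`:
`∀ Y ∈ T, (L^k)⁻²·dirSq Y F ≤ K·curlSq 1 Y F` ((w2) turns the HS gradient energy into the HS curl energy, which is at most the
operator-norm `curlSq`).  «At `W = flatCfg` (P_W) follows from (w2) + (w3) + the Landau condition» — here it is. [folklore] -/
theorem weightedPoincare_flatCfg_of_dirSq_le {L N k : ℕ} (hNL : 1 ≤ N * L ^ k)
    {T : Set (Site d → Fin d → Matrix n n ℂ)} {K : ℝ} (hK : 0 ≤ K)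
    (hper : ∀ Y ∈ T, IsPeriodicDir Y ((N * L ^ k : ℕ) : ℤ)) (hdiv : ∀ Y ∈ T, ∀ x : Site d, flatDiv Y x = 0)
    (hP : ∀ Y ∈ T, dirSq Y (periodBox (N * L ^ k)) ≤ K * (((L : ℝ) ^ k) ^ 2 *
      ∑ x ∈ periodBox (N * L ^ k), ∑ μ : Fin d, ∑ ν : Fin d, nhsNormSq (Y (x + e μ) ν - Y x ν))) :
    ∀ Y ∈ T, (((L : ℝ) ^ k)⁻¹) ^ 2 * dirSq Y (periodBox (N * L ^ k))
      ≤ K * curlSq (flatCfg (d := d) (n := n)) Y (periodBox (N * L ^ k)) := by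
  intro Y hY
  set F : Finset (Site d) := periodBox (N * L ^ k) with hF
  have hG : ∑ x ∈ F, ∑ μ : Fin d, ∑ ν : Fin d, nhsNormSq (Y (x + e μ) ν - Y x ν)
      ≤ curlSq (flatCfg (d := d) (n := n)) Y F := by
    rw [weitzenbock_nhs_periodBox_of_flatDiv_eq_zero hNL (hper Y hY) (fun x => hdiv Y hY x)]
    exact sum_nhsNormSq_curl_le_curlSq Y F
  have hC0 : 0 ≤ curlSq (flatCfg (d := d) (n := n)) Y F := by unfold curlSq; positivity
  have hPY : dirSq Y F ≤ K * (((L : ℝ) ^ k) ^ 2 * curlSq (flatCfg (d := d) (n := n)) Y F) :=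
    (hP Y hY).trans (mul_le_mul_of_nonneg_left (mul_le_mul_of_nonneg_left hG (sq_nonneg _)) hK)
  by_cases hLk : ((L : ℝ) ^ k) = 0
  · rw [hLk, inv_zero, zero_pow two_ne_zero, zero_mul]
    exact mul_nonneg hK hC0
  · calc (((L : ℝ) ^ k)⁻¹) ^ 2 * dirSq Y F
        ≤ (((L : ℝ) ^ k)⁻¹) ^ 2 * (K * (((L : ℝ) ^ k) ^ 2 * curlSq (flatCfg (d := d) (n := n)) Y F)) :=
          mul_le_mul_of_nonneg_left hPY (sq_nonneg _)
      _ = K * curlSq (flatCfg (d := d) (n := n)) Y F * ((((L : ℝ) ^ k)⁻¹) * (L : ℝ) ^ k) ^ 2 := by ring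
      _ = K * curlSq (flatCfg (d := d) (n := n)) Y F := by rw [inv_mul_cancel₀ hLk, one_pow, mul_one]

/-- **(ML_w) AT THE FLAT BACKGROUND, MODULO THE POINCARÉ LEAF IN THE HS CURRENCY — THE OWNER'S CONSTANT
`c_w(flat) = 1/(n(1 + C_P))`.**  If on `T` (skew, `(N·L^k)`-periodic, `flatDiv`-free fields)
`Σ_F Σ_κ nhsNormSq (Y x κ) ≤ C_P·(L^k)²·Σ_F Σ_μ Σ_ν nhsNormSq (Y(x+e_μ)_ν − Y(x)_ν)` (`C_P ≥ 0`), then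
`WeightedTangentCoercive L k 1 T (1/(card n·(1 + C_P))) [0, N·L^k)^d`. [folklore] -/
theorem weightedTangentCoercive_flatCfg_of_poincare [Nonempty n] {L N k : ℕ} (hNL : 1 ≤ N * L ^ k)
    {T : Set (Site d → Fin d → Matrix n n ℂ)} {CP : ℝ} (hCP : 0 ≤ CP)
    (hskew : ∀ Y ∈ T, IsSkewDir Y) (hper : ∀ Y ∈ T, IsPeriodicDir Y ((N * L ^ k : ℕ) : ℤ))
    (hdiv : ∀ Y ∈ T, ∀ x : Site d, flatDiv Y x = 0)
    (hP : ∀ Y ∈ T, ∑ x ∈ periodBox (N * L ^ k), ∑ κ : Fin d, nhsNormSq (Y x κ) ≤ CP * (((L : ℝ) ^ k) ^ 2 *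
      ∑ x ∈ periodBox (N * L ^ k), ∑ μ : Fin d, ∑ ν : Fin d, nhsNormSq (Y (x + e μ) ν - Y x ν))) :
    WeightedTangentCoercive L k (flatCfg (d := d) (n := n)) T (1 / (Fintype.card n * (1 + CP)))
      (periodBox (N * L ^ k)) := by
  have hK : 0 ≤ (Fintype.card n : ℝ) * CP := by positivity
  have h := weightedTangentCoercive_flatCfg_of_dirSq_le (d := d) hNL hK hskew hper hdiv (fun Y hY => by
    have hG0 : 0 ≤ ((L : ℝ) ^ k) ^ 2 *
        ∑ x ∈ periodBox (N * L ^ k), ∑ μ : Fin d, ∑ ν : Fin d, nhsNormSq (Y (x + e μ) ν - Y x ν) := by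
      have : 0 ≤ ∑ x ∈ periodBox (N * L ^ k), ∑ μ : Fin d, ∑ ν : Fin d, nhsNormSq (Y (x + e μ) ν - Y x ν) :=
        Finset.sum_nonneg fun _ _ => Finset.sum_nonneg fun _ _ => Finset.sum_nonneg fun _ _ => nhsNormSq_nonneg _
      positivity
    calc dirSq Y (periodBox (N * L ^ k))
        ≤ Fintype.card n * ∑ x ∈ periodBox (N * L ^ k), ∑ κ : Fin d, nhsNormSq (Y x κ) := dirSq_le_card_mul Y _
      _ ≤ Fintype.card n * (CP * (((L : ℝ) ^ k) ^ 2 *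
          ∑ x ∈ periodBox (N * L ^ k), ∑ μ : Fin d, ∑ ν : Fin d, nhsNormSq (Y (x + e μ) ν - Y x ν))) :=
        mul_le_mul_of_nonneg_left (hP Y hY) (Nat.cast_nonneg _)
      _ = Fintype.card n * CP * (((L : ℝ) ^ k) ^ 2 *
          ∑ x ∈ periodBox (N * L ^ k), ∑ μ : Fin d, ∑ ν : Fin d, nhsNormSq (Y (x + e μ) ν - Y x ν)) := by ring)
  rwa [show (Fintype.card n : ℝ) + Fintype.card n * CP = Fintype.card n * (1 + CP) by ring] at h

/-- Operator-norm gradient energy `≤ card n ×` HS gradient energy (`‖X‖² ≤ card n · nhsNormSq X` termwise). [folklore] -/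
theorem sum_opNorm_grad_le_card_mul (Y : Site d → Fin d → Matrix n n ℂ) (F : Finset (Site d)) :
    ∑ x ∈ F, ∑ μ : Fin d, ∑ ν : Fin d, ‖Y (x + e μ) ν - Y x ν‖ ^ 2
      ≤ Fintype.card n * ∑ x ∈ F, ∑ μ : Fin d, ∑ ν : Fin d, nhsNormSq (Y (x + e μ) ν - Y x ν) := by
  rw [Finset.mul_sum]
  refine Finset.sum_le_sum fun x _ => ?_
  rw [Finset.mul_sum]
  refine Finset.sum_le_sum fun μ _ => ?_
  rw [Finset.mul_sum]
  exact Finset.sum_le_sum fun ν _ => MatrixNorms.opNorm_sq_le_card_mul_nhsNormSq _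

/-- **(ML_w) AT THE FLAT BACKGROUND, MODULO THE POINCARÉ LEAF IN THE OPERATOR-NORM CURRENCY ON BOTH SIDES** (the (P) of
row E-MLw-w3's SHAPE v1: `dirSq Y F ≤ C·(L^k)²·Σ_F Σ_μ Σ_ν ‖Y(x+e_μ)_ν − Y(x)_ν‖²`): constant `1/(card n·(1 + C))`. [folklore] -/
theorem weightedTangentCoercive_flatCfg_of_dirSq_le_opGrad [Nonempty n] {L N k : ℕ} (hNL : 1 ≤ N * L ^ k)
    {T : Set (Site d → Fin d → Matrix n n ℂ)} {C : ℝ} (hC : 0 ≤ C)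
    (hskew : ∀ Y ∈ T, IsSkewDir Y) (hper : ∀ Y ∈ T, IsPeriodicDir Y ((N * L ^ k : ℕ) : ℤ))
    (hdiv : ∀ Y ∈ T, ∀ x : Site d, flatDiv Y x = 0)
    (hP : ∀ Y ∈ T, dirSq Y (periodBox (N * L ^ k)) ≤ C * (((L : ℝ) ^ k) ^ 2 *
      ∑ x ∈ periodBox (N * L ^ k), ∑ μ : Fin d, ∑ ν : Fin d, ‖Y (x + e μ) ν - Y x ν‖ ^ 2)) :
    WeightedTangentCoercive L k (flatCfg (d := d) (n := n)) T (1 / (Fintype.card n * (1 + C)))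
      (periodBox (N * L ^ k)) := by
  have hK : 0 ≤ (Fintype.card n : ℝ) * C := by positivity
  have h := weightedTangentCoercive_flatCfg_of_dirSq_le (d := d) hNL hK hskew hper hdiv (fun Y hY => by
    have hL0 : 0 ≤ ((L : ℝ) ^ k) ^ 2 := sq_nonneg _
    calc dirSq Y (periodBox (N * L ^ k))
        ≤ C * (((L : ℝ) ^ k) ^ 2 *
          ∑ x ∈ periodBox (N * L ^ k), ∑ μ : Fin d, ∑ ν : Fin d, ‖Y (x + e μ) ν - Y x ν‖ ^ 2) := hP Y hY
      _ ≤ C * (((L : ℝ) ^ k) ^ 2 * (Fintype.card n *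
          ∑ x ∈ periodBox (N * L ^ k), ∑ μ : Fin d, ∑ ν : Fin d, nhsNormSq (Y (x + e μ) ν - Y x ν))) :=
        mul_le_mul_of_nonneg_left (mul_le_mul_of_nonneg_left (sum_opNorm_grad_le_card_mul Y _) hL0) hC
      _ = Fintype.card n * C * (((L : ℝ) ^ k) ^ 2 *
          ∑ x ∈ periodBox (N * L ^ k), ∑ μ : Fin d, ∑ ν : Fin d, nhsNormSq (Y (x + e μ) ν - Y x ν)) := by ring)
  rwa [show (Fintype.card n : ℝ) + Fintype.card n * C = Fintype.card n * (1 + C) by ring] at h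

/-! ## §3 On the constrained Landau tangent space `flatTangentLandau L N k` -/

/-- **(ML_w) AT THE FLAT BACKGROUND ON `flatTangentLandau L N k`, MODULO THE POINCARÉ LEAF (w3)** (operator-norm bond energy
form, constant `1/(card n + K)`): the skew ∕ periodic ∕ divergence-free clauses come from membership; the Poincaré hypothesis
is quantified over the constrained tangent space, where (w3) may use `TangentIter L (k−1) 1 Y`. [folklore] -/
theorem weightedTangentCoercive_flatTangentLandau_of_dirSq_le [Nonempty n] {L N k : ℕ} (hNL : 1 ≤ N * L ^ k) {K : ℝ}
    (hK : 0 ≤ K)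
    (hP : ∀ Y ∈ flatTangentLandau (d := d) (n := n) L N k, dirSq Y (periodBox (N * L ^ k)) ≤ K * (((L : ℝ) ^ k) ^ 2 *
      ∑ x ∈ periodBox (N * L ^ k), ∑ μ : Fin d, ∑ ν : Fin d, nhsNormSq (Y (x + e μ) ν - Y x ν))) :
    WeightedTangentCoercive L k (flatCfg (d := d) (n := n)) (flatTangentLandau L N k) (1 / (Fintype.card n + K))
      (periodBox (N * L ^ k)) :=
  weightedTangentCoercive_flatCfg_of_dirSq_le hNL hK (fun _ hY => hY.1) (fun _ hY => hY.2.1) (fun _ hY => hY.2.2.2) hP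

/-- **(ML_w) AT THE FLAT BACKGROUND ON `flatTangentLandau L N k` WITH THE OWNER'S CONSTANT `1/(n(1 + C_P))`, MODULO THE
POINCARÉ LEAF (w3) IN THE HS CURRENCY.** [folklore] -/
theorem weightedTangentCoercive_flatTangentLandau_of_poincare [Nonempty n] {L N k : ℕ} (hNL : 1 ≤ N * L ^ k) {CP : ℝ}
    (hCP : 0 ≤ CP)
    (hP : ∀ Y ∈ flatTangentLandau (d := d) (n := n) L N k,
      ∑ x ∈ periodBox (N * L ^ k), ∑ κ : Fin d, nhsNormSq (Y x κ) ≤ CP * (((L : ℝ) ^ k) ^ 2 *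
        ∑ x ∈ periodBox (N * L ^ k), ∑ μ : Fin d, ∑ ν : Fin d, nhsNormSq (Y (x + e μ) ν - Y x ν))) :
    WeightedTangentCoercive L k (flatCfg (d := d) (n := n)) (flatTangentLandau L N k) (1 / (Fintype.card n * (1 + CP)))
      (periodBox (N * L ^ k)) :=
  weightedTangentCoercive_flatCfg_of_poincare hNL hCP (fun _ hY => hY.1) (fun _ hY => hY.2.1) (fun _ hY => hY.2.2.2) hP

/-- **(ML_w) AT THE FLAT BACKGROUND ON `flatTangentLandau L N k`, MODULO THE POINCARÉ LEAF (w3) IN ITS OWN SHAPE** — the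
hypothesis is LITERALLY row E-MLw-w3's planned END `dirSq_le_of_tangentIter_flat` quantified over the constrained tangent space
(periodicity and `TangentIter L (k−1) 1` are the membership clauses it consumes): constant `1/(card n·(1 + C))`. [folklore] -/
theorem weightedTangentCoercive_flatTangentLandau_of_dirSq_le_opGrad [Nonempty n] {L N k : ℕ} (hNL : 1 ≤ N * L ^ k)
    {C : ℝ} (hC : 0 ≤ C)
    (hP : ∀ Y ∈ flatTangentLandau (d := d) (n := n) L N k, dirSq Y (periodBox (N * L ^ k)) ≤ C * (((L : ℝ) ^ k) ^ 2 *
      ∑ x ∈ periodBox (N * L ^ k), ∑ μ : Fin d, ∑ ν : Fin d, ‖Y (x + e μ) ν - Y x ν‖ ^ 2)) :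
    WeightedTangentCoercive L k (flatCfg (d := d) (n := n)) (flatTangentLandau L N k) (1 / (Fintype.card n * (1 + C)))
      (periodBox (N * L ^ k)) :=
  weightedTangentCoercive_flatCfg_of_dirSq_le_opGrad hNL hC (fun _ hY => hY.1) (fun _ hY => hY.2.1)
    (fun _ hY => hY.2.2.2) hP

/-! ## §4 The hook for row E-MLw-w3's END, literally -/

/-- **(ML_w) AT THE FLAT BACKGROUND ON `flatTangentLandau L N k` FROM ROW E-MLw-w3's END IN ITS LITERAL SHAPE** (leaf-04-g4,
journal «GO w2-asm», 2026-08-20T13:37Z: `sum_nhsNormSq_le_of_tangentIter_flat (hL : 1 ≤ L) (hN : 1 ≤ N) (hYper : IsPeriodicDir Y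
(N·L^(j+1))) (hY : TangentIter L j BlockAveragePushDirSplit.flat Y) : Σ_x Σ_κ nhsNormSq (Y x κ) ≤ C_P·(L^(j+1))²·Σ_x Σ_κ Σ_μ
nhsNormSq (Y(x+e_μ)_κ − Y(x)_κ)` with `C_P = 5 + 2·d·N²`): for `k ≥ 1` the block-Poincaré bound at level `j = k − 1`, in that
component-outside∕direction-inside order and with `BlockAveragePushDirSplit.flat` (≡ `flatCfg` by `rfl`), yields
`WeightedTangentCoercive L k 1 (flatTangentLandau L N k) (1/(card n·(1 + C_P))) [0, N·L^k)^d`.  The discharge on (w3)'s side is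
`fun j Y hper htan => sum_nhsNormSq_le_of_tangentIter_flat hL hN hper htan` (with `C_P := 5 + 2*d*N^2`, `0 ≤ C_P` by
`positivity`); the Landau clause of the tangent space is used by (w2), not by (w3). [folklore] -/
theorem weightedTangentCoercive_flatTangentLandau_of_blockPoincare [Nonempty n] {L N : ℕ} (hL : 1 ≤ L) (hN : 1 ≤ N)
    {k : ℕ} (hk : 1 ≤ k) {CP : ℝ} (hCP : 0 ≤ CP)
    (hP : ∀ (j : ℕ) (Y : Site d → Fin d → Matrix n n ℂ), IsPeriodicDir Y ((N * L ^ (j + 1) : ℕ) : ℤ) →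
      AveragingDeficitMultiLevelPrep.TangentIter L j (BlockAveragePushDirSplit.flat (d := d) (n := n)) Y →
        ∑ x ∈ periodBox (N * L ^ (j + 1)), ∑ κ : Fin d, nhsNormSq (Y x κ)
          ≤ CP * ((L : ℝ) ^ (j + 1)) ^ 2 *
            ∑ x ∈ periodBox (N * L ^ (j + 1)), ∑ κ : Fin d, ∑ μ : Fin d, nhsNormSq (Y (x + e μ) κ - Y x κ)) :
    WeightedTangentCoercive L k (flatCfg (d := d) (n := n)) (flatTangentLandau L N k) (1 / (Fintype.card n * (1 + CP)))
      (periodBox (N * L ^ k)) := by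
  obtain ⟨j, rfl⟩ : ∃ j, k = j + 1 := ⟨k - 1, by omega⟩
  have hNL : 1 ≤ N * L ^ (j + 1) := Nat.mul_pos (by omega) (Nat.pow_pos (by omega))
  refine weightedTangentCoercive_flatTangentLandau_of_poincare hNL hCP fun Y hY => ?_
  have htan : AveragingDeficitMultiLevelPrep.TangentIter L j (BlockAveragePushDirSplit.flat (d := d) (n := n)) Y := by
    have h1 : AveragingDeficitMultiLevelPrep.TangentIter L (j + 1 - 1) (flatCfg (d := d) (n := n)) Y := hY.2.2.1
    rw [Nat.add_sub_cancel] at h1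
    exact h1
  have h := hP j Y hY.2.1 htan
  have hS : ∑ x ∈ periodBox (N * L ^ (j + 1)), ∑ κ : Fin d, ∑ μ : Fin d, nhsNormSq (Y (x + e μ) κ - Y x κ)
      = ∑ x ∈ periodBox (N * L ^ (j + 1)), ∑ μ : Fin d, ∑ ν : Fin d, nhsNormSq (Y (x + e μ) ν - Y x ν) :=
    Finset.sum_congr rfl fun _ _ => Finset.sum_comm
  rw [hS, mul_assoc] at h
  exact h

/-- **(P_W) AT `W = 1` ON `flatTangentLandau L N k` FROM ROW E-MLw-w3's END IN ITS LITERAL SHAPE**, in the currency of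
`NE3WeightedCoercivityTransfer`'s (P_U) (leaf-03-g6): `∀ Y ∈ flatTangentLandau L N k, (L^k)⁻²·dirSq Y F ≤ (card n·C_P)·curlSq 1 Y F`
(`F = [0, N·L^k)^d`, `k ≥ 1`) — the two §4b suppliers (w3) → (w4-T) meet here at the flat background. [folklore] -/
theorem weightedPoincare_flatTangentLandau_of_blockPoincare [Nonempty n] {L N : ℕ} (hL : 1 ≤ L) (hN : 1 ≤ N)
    {k : ℕ} (hk : 1 ≤ k) {CP : ℝ} (hCP : 0 ≤ CP)
    (hP : ∀ (j : ℕ) (Y : Site d → Fin d → Matrix n n ℂ), IsPeriodicDir Y ((N * L ^ (j + 1) : ℕ) : ℤ) →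
      AveragingDeficitMultiLevelPrep.TangentIter L j (BlockAveragePushDirSplit.flat (d := d) (n := n)) Y →
        ∑ x ∈ periodBox (N * L ^ (j + 1)), ∑ κ : Fin d, nhsNormSq (Y x κ)
          ≤ CP * ((L : ℝ) ^ (j + 1)) ^ 2 *
            ∑ x ∈ periodBox (N * L ^ (j + 1)), ∑ κ : Fin d, ∑ μ : Fin d, nhsNormSq (Y (x + e μ) κ - Y x κ)) :
    ∀ Y ∈ flatTangentLandau (d := d) (n := n) L N k, (((L : ℝ) ^ k)⁻¹) ^ 2 * dirSq Y (periodBox (N * L ^ k))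
      ≤ (Fintype.card n * CP) * curlSq (flatCfg (d := d) (n := n)) Y (periodBox (N * L ^ k)) := by
  obtain ⟨j, rfl⟩ : ∃ j, k = j + 1 := ⟨k - 1, by omega⟩
  have hNL : 1 ≤ N * L ^ (j + 1) := Nat.mul_pos (by omega) (Nat.pow_pos (by omega))
  have hK : 0 ≤ (Fintype.card n : ℝ) * CP := by positivity
  refine weightedPoincare_flatCfg_of_dirSq_le hNL hK (fun _ hY => hY.2.1) (fun _ hY => hY.2.2.2) fun Y hY => ?_
  have htan : AveragingDeficitMultiLevelPrep.TangentIter L j (BlockAveragePushDirSplit.flat (d := d) (n := n)) Y := by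
    have h1 : AveragingDeficitMultiLevelPrep.TangentIter L (j + 1 - 1) (flatCfg (d := d) (n := n)) Y := hY.2.2.1
    rw [Nat.add_sub_cancel] at h1
    exact h1
  have h := hP j Y hY.2.1 htan
  have hS : ∑ x ∈ periodBox (N * L ^ (j + 1)), ∑ κ : Fin d, ∑ μ : Fin d, nhsNormSq (Y (x + e μ) κ - Y x κ)
      = ∑ x ∈ periodBox (N * L ^ (j + 1)), ∑ μ : Fin d, ∑ ν : Fin d, nhsNormSq (Y (x + e μ) ν - Y x ν) :=
    Finset.sum_congr rfl fun _ _ => Finset.sum_comm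
  rw [hS, mul_assoc] at h
  calc dirSq Y (periodBox (N * L ^ (j + 1)))
      ≤ Fintype.card n * ∑ x ∈ periodBox (N * L ^ (j + 1)), ∑ κ : Fin d, nhsNormSq (Y x κ) := dirSq_le_card_mul Y _
    _ ≤ Fintype.card n * (CP * (((L : ℝ) ^ (j + 1)) ^ 2 *
        ∑ x ∈ periodBox (N * L ^ (j + 1)), ∑ μ : Fin d, ∑ ν : Fin d, nhsNormSq (Y (x + e μ) ν - Y x ν))) :=
      mul_le_mul_of_nonneg_left h (Nat.cast_nonneg _)
    _ = Fintype.card n * CP * (((L : ℝ) ^ (j + 1)) ^ 2 *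
        ∑ x ∈ periodBox (N * L ^ (j + 1)), ∑ μ : Fin d, ∑ ν : Fin d, nhsNormSq (Y (x + e μ) ν - Y x ν)) := by ring

end

end Summit.QuantumFields.BalabanUV.T4Continuum.NE3FlatWeightedCoercive
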